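/-
Origin: expansion seat `planner-pub-hodgecm-pv13-0`, handover 2026-08-18T04:08:43Z (`HOME/pub-hodgecm-pv13/lean/Pv13/EulerFactorisation.lean`, md5 a223e9a4, 259 lines);
landed by the gen-5 packager in gate run 21 as `HodgeCM/PerL34/EulerFactorisation.lean` (verbatim).
-/
/-
Origin: pub-hodgecm-pv13 (DAG-NODE PROVER #13), seam (I) of the N31 cluster (GAPS.md pv05-X1 table, row
"N31e → N31 (`LocalFactorDatum.rallis`)", binder `hEuler` of `RallisIP.rallis_field_of_N31e`, OWNER pv13/pv07):
"the adelic matrix-coefficient integral converges absolutely and FACTORISES OVER PLACES for pure tensors"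
(PerL v5 ll. 608–612).  Mathlib-only.  Proposed place: `HodgeCM/PerL34/EulerFactorisation.lean`,
namespace `HodgeCM.PerL34.EulerFactorisation`.  Nothing cited, nothing asserted.
-/
import Mathlib.MeasureTheory.Integral.Pi
import Mathlib.MeasureTheory.Integral.Prod
import Mathlib.MeasureTheory.Integral.Bochner.Set
import Mathlib.Topology.Algebra.InfiniteSum.Basic
import Mathlib.Analysis.Complex.Basic

set_option autoImplicit false

/-!
# Euler factorisation of an adelic integral over an exhaustion by finite sets of places

PerL v5 l. 608–609: "for `φ = ⊗_v φ_v` the adelic integral `∫_{U(W_i)(𝔸)} ⟨ω(y)φ,φ⟩ χ'(y) dy` is the Euler product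
`∏_v I_v(φ_v)`, `I_v(φ_v) = ∫_{U(W_i)(L_{0,v})} ⟨ω_v(y)φ_v,φ_v⟩ χ'_v(y) dy`".  The N31 cluster consumes this as the
binder `hEuler : ∫ y, ⟪φ, ω y φ⟫ * χ' y ∂μ = (P : ℂ)` (`RallisIP.rallis_field_of_N31e`, pv09) with `P = ∏' v, I v`
(`EulerProduct.LocalFactorDatum.rallis`, pv13).  This file proves the MEASURE-THEORETIC content of the sentence and
leaves the restricted-product STRUCTURE as typed data:

* `integral_eq_of_hasProd_exhaustion` — KERNEL: if measurable sets `G_S` (indexed by finite sets `S` of a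
  countable index type, monotone, covering) exhaust `X`, `F` is integrable, and for all large `S` the integral of
  `F` over `G_S` is the finite product `∏_{v∈S} I_v` of numbers with `HasProd I P`, then `∫_X F = P`
  (monotone exhaustion of the Bochner integral + uniqueness of limits).
* `setIntegral_eq_prod_of_level` — KERNEL: if `G_S` is, as a measure space, the image of
  `(∏_{v∈S} G_v) × Y_S` (`Y_S` a probability space: "`∏_{v∉S} K_v` with its Haar probability measure") under a
  measurable embedding pushing `(⊗_{v∈S} μ_v) ⊗ ν_S` to `μ|_{G_S}`, and `F` pulled back is the pure tensor
  `∏_{v∈S} f_v(y_v)` ("`φ = ⊗φ_v`, `φ_v = φ⁰_v` fixed by `K_v` and `χ'_v` unramified off `S`"), then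
  `∫_{G_S} F dμ = ∏_{v∈S} ∫ f_v dμ_v` (Fubini for finite products).
* `EulerFactorisation.Datum μ F V` — the typed DATA of a restricted product seen from `X = U(W_i)(𝔸)`: local measure
  spaces `(G_v, μ_v)`, local integrands `f_v`, the exhaustion `G_S`, the level embeddings and the two identities
  above as FIELDS (restricted-product Haar measure = LEMMAS §3 vocabulary; pure-tensor factorisation of the matrix
  coefficient = definition of `ω = ⊗'_v ω_v` on pure tensors), global integrability of `F` (l. 608, stable range)
  and `Multipliable (v ↦ ∫ f_v)` (for the cluster's `I_v` this is the THEOREM `EulerProduct.hasProd_eulerValue`).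
* `Datum.integral_eq_tprod` — `∫_X F dμ = ∏' v, ∫ f_v dμ_v`, and `hEuler_of` — exactly the shape of
  pv09's binder with a real `P` when the local integrals are real (l. 612).
-/

noncomputable section

open MeasureTheory Filter Topology
open scoped BigOperators

namespace HodgeCM
namespace PerL34
namespace EulerFactorisation

/-! ### 1. The limit over finite sets of places -/

section Exhaustion

variable {X : Type*} [MeasurableSpace X] {μ : Measure X} {V : Type*} [Countable V]

/-- **Exhaustion ⇒ Euler product (kernel).**  `G_S ↑ X` measurable, monotone in `S`, covering; `F` integrable;
`∫_{G_S} F = ∏_{v∈S} I_v` for all large `S`; `HasProd I P`.  Then `∫_X F = P`. -/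
theorem integral_eq_of_hasProd_exhaustion (G : Finset V → Set X) (hGm : ∀ S, MeasurableSet (G S))
    (hmono : Monotone G) (hcover : ∀ x, ∃ S, x ∈ G S) {F : X → ℂ} (hF : Integrable F μ)
    {I : V → ℂ} {P : ℂ} (hP : HasProd I P)
    (hloc : ∀ᶠ S in atTop, ∫ x in G S, F x ∂μ = ∏ v ∈ S, I v) :
    ∫ x, F x ∂μ = P := by
  have hU : (⋃ S, G S) = Set.univ := Set.eq_univ_of_forall fun x => Set.mem_iUnion.mpr (hcover x)
  have h1 : Tendsto (fun S => ∫ x in G S, F x ∂μ) atTop (𝓝 (∫ x, F x ∂μ)) := by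
    have h := tendsto_setIntegral_of_monotone (μ := μ) (f := F) hGm hmono (hF.integrableOn)
    rwa [hU, Measure.restrict_univ] at h
  have h2 : Tendsto (fun S : Finset V => ∏ v ∈ S, I v) atTop (𝓝 P) := by
    simpa [HasProd] using hP
  exact tendsto_nhds_unique (h1.congr' hloc) h2

/-- The same with `∏'`. -/
theorem integral_eq_tprod_of_exhaustion (G : Finset V → Set X) (hGm : ∀ S, MeasurableSet (G S))
    (hmono : Monotone G) (hcover : ∀ x, ∃ S, x ∈ G S) {F : X → ℂ} (hF : Integrable F μ)
    {I : V → ℂ} (hI : Multipliable I)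
    (hloc : ∀ᶠ S in atTop, ∫ x in G S, F x ∂μ = ∏ v ∈ S, I v) :
    ∫ x, F x ∂μ = ∏' v, I v :=
  integral_eq_of_hasProd_exhaustion G hGm hmono hcover hF hI.hasProd hloc

end Exhaustion

/-! ### 2. One level: Fubini for `(∏_{v∈S} G_v) × K^S` -/

section Level

variable {X : Type*} [MeasurableSpace X] {μ : Measure X}
variable {ι : Type*} [Fintype ι] {Gv : ι → Type*} [∀ i, MeasurableSpace (Gv i)]
variable {Y : Type*} [MeasurableSpace Y]

/-- **One level of the exhaustion (kernel).**  `emb : (∏_i G_i) × Y → X` a measurable embedding with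
`map emb ((⊗ μ_i) ⊗ ν) = μ|_{G}` (`ν` a probability measure), and `F ∘ emb (y, k) = ∏_i f_i(y_i)`.  Then
`∫_G F dμ = ∏_i ∫ f_i dμ_i`. -/
theorem setIntegral_eq_prod_of_level (μv : ∀ i, Measure (Gv i)) [∀ i, SigmaFinite (μv i)]
    (ν : Measure Y) [IsProbabilityMeasure ν] {G : Set X} (emb : (∀ i, Gv i) × Y → X)
    (hemb : MeasurableEmbedding emb) (hmap : Measure.map emb ((Measure.pi μv).prod ν) = μ.restrict G)
    {F : X → ℂ} (fv : ∀ i, Gv i → ℂ) (hF : ∀ p, F (emb p) = ∏ i, fv i (p.1 i)) :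
    ∫ x in G, F x ∂μ = ∏ i, ∫ y, fv i y ∂(μv i) := by
  rw [← hmap, hemb.integral_map]
  simp_rw [hF]
  have h : ∫ p : (∀ i, Gv i) × Y, ∏ i, fv i (p.1 i) ∂((Measure.pi μv).prod ν) =
      (∫ y : ∀ i, Gv i, ∏ i, fv i (y i) ∂(Measure.pi μv)) * ∫ _k : Y, (1 : ℂ) ∂ν := by
    rw [← integral_prod_mul]
    simp
  rw [h, integral_fintype_prod_eq_prod]
  simp

end Level

/-! ### 3. The typed data of a restricted product seen from the adelic group, and the factorisation -/

/-- **Typed restricted-product data for an adelic integral** `∫_X F dμ` (`X = U(W_i)(𝔸)`, `μ` its Haar measure,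
`F(y) = ⟨ω(y)φ,φ⟩χ'(y)` for a pure tensor `φ = ⊗_v φ_v`).  Every field is either restricted-product STRUCTURE
(LEMMAS §3 vocabulary: `X = ⋃_S G_S`, `G_S ≅ ∏_{v∈S} G_v × ∏_{v∉S} K_v` with `μ|_{G_S} = ⊗_{v∈S} μ_v ⊗ Haar^{prob}`)
or the DEFINITION of the global objects as restricted tensor products (`F|_{G_S} = ∏_{v∈S} f_v`, because
`φ_v = φ⁰_v` is `K_v`-fixed and `χ'_v|_{K_v} = 1` for `v ∉ S ⊇ S₀`), or an analytic input named in the tex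
(`integrable`: l. 608 "the integral converges absolutely in the stable range"; `multipliable`: for the N31
cluster's `I_v` the theorem `EulerProduct.hasProd_eulerValue`). -/
structure Datum {X : Type*} [MeasurableSpace X] (μ : Measure X) (F : X → ℂ) (V : Type)
    [Countable V] where
  /-- exceptional finite set of places (archimedean, ramified) -/
  S₀ : Finset V
  /-- the local groups `G_v = U(W_i)(L_{0,v})` as measure spaces, Haar measures `μ_v` (σ-finite) -/
  Gv : V → Type
  [mGv : ∀ v, MeasurableSpace (Gv v)]
  μv : ∀ v, Measure (Gv v)
  [sfv : ∀ v, SigmaFinite (μv v)]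
  /-- the local integrands `f_v(y) = ⟨ω_v(y)φ_v,φ_v⟩ χ'_v(y)` -/
  fv : ∀ v, Gv v → ℂ
  /-- the exhaustion `G_S = ∏_{v∈S} G_v × ∏_{v∉S} K_v ⊆ X` -/
  G : Finset V → Set X
  G_meas : ∀ S, MeasurableSet (G S)
  G_mono : Monotone G
  G_cover : ∀ x, ∃ S, x ∈ G S
  /-- the compact factor `∏_{v∉S} K_v` with its Haar PROBABILITY measure -/
  Y : Finset V → Type
  [mY : ∀ S, MeasurableSpace (Y S)]
  ν : ∀ S, Measure (Y S)
  [probY : ∀ S, IsProbabilityMeasure (ν S)]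
  /-- the level isomorphism `(∏_{v∈S} G_v) × ∏_{v∉S} K_v → G_S ⊆ X` … -/
  emb : ∀ S : Finset V, ((∀ v : S, Gv v) × Y S) → X
  emb_measurableEmbedding : ∀ S, S₀ ⊆ S → MeasurableEmbedding (emb S)
  /-- … identifying the measures (restricted-product Haar measure) … -/
  map_emb : ∀ S, S₀ ⊆ S → Measure.map (emb S) ((Measure.pi fun v : S => μv v).prod (ν S)) = μ.restrict (G S)
  /-- … under which `F` is the pure tensor `∏_{v∈S} f_v` (the factors off `S` being `≡ 1` on `K_v`) -/
  pure_tensor : ∀ S, S₀ ⊆ S → ∀ p, F (emb S p) = ∏ v : S, fv v (p.1 v)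
  /-- l. 608: global absolute convergence -/
  integrable : Integrable F μ
  /-- convergence of the Euler product of the local integrals -/
  multipliable : Multipliable fun v => ∫ y, fv v y ∂(μv v)

namespace Datum

attribute [instance] Datum.mGv Datum.sfv Datum.mY Datum.probY

variable {X : Type*} [MeasurableSpace X] {μ : Measure X} {F : X → ℂ} {V : Type} [Countable V]

/-- The local factor `I_v = ∫_{G_v} f_v dμ_v`. -/
def I (D : Datum μ F V) (v : V) : ℂ := ∫ y, D.fv v y ∂(D.μv v)

/-- At every level `S ⊇ S₀`: `∫_{G_S} F dμ = ∏_{v∈S} I_v`. -/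
theorem setIntegral_level (D : Datum μ F V) (S : Finset V) (hS : D.S₀ ⊆ S) :
    ∫ x in D.G S, F x ∂μ = ∏ v ∈ S, D.I v := by
  rw [setIntegral_eq_prod_of_level (fun v : S => D.μv v) (D.ν S) (D.emb S) (D.emb_measurableEmbedding S hS)
    (D.map_emb S hS) (fun v : S => D.fv v) (D.pure_tensor S hS)]
  exact Finset.prod_coe_sort S D.I

/-- **Euler factorisation** (tex l. 608–609): `∫_X F dμ = ∏'_v I_v`, and the product converges to it. -/
theorem hasProd_integral (D : Datum μ F V) : HasProd D.I (∫ x, F x ∂μ) := by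
  have h := integral_eq_of_hasProd_exhaustion D.G D.G_meas D.G_mono D.G_cover D.integrable
    D.multipliable.hasProd (Filter.eventually_atTop.mpr ⟨D.S₀, fun S hS => D.setIntegral_level S hS⟩)
  rw [h]
  exact D.multipliable.hasProd

/-- (Ported verbatim from the HodgeCMPerL package; no docstring in the source.) -/
theorem integral_eq_tprod (D : Datum μ F V) : ∫ x, F x ∂μ = ∏' v, D.I v :=
  integral_eq_tprod_of_exhaustion D.G D.G_meas D.G_mono D.G_cover D.integrable D.multipliable
    (Filter.eventually_atTop.mpr ⟨D.S₀, fun S hS => D.setIntegral_level S hS⟩)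

/-- **The consumed shape** (`RallisIP.rallis_field_of_N31e`, binder `hEuler`, with l. 612 "`I_v` is real"):
if the local integrals are real numbers `I_v` with `HasProd I P`, then `∫_X F dμ = (P : ℂ)`. -/
theorem hEuler_of (D : Datum μ F V) {Ir : V → ℝ} {P : ℝ} (hIr : ∀ v, D.I v = (Ir v : ℂ))
    (hP : HasProd Ir P) : ∫ x, F x ∂μ = (P : ℂ) := by
  have h1 : HasProd D.I (∫ x, F x ∂μ) := D.hasProd_integral
  have h2 : HasProd D.I ((P : ℝ) : ℂ) := by
    have h := hP.map Complex.ofRealHom Complex.continuous_ofReal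
    have hfun : (⇑Complex.ofRealHom ∘ Ir) = D.I := funext fun v => by simp [hIr v]
    rwa [hfun] at h
  exact h1.unique h2

end Datum

/-! ### 4. Non-vacuity: the one-place datum -/

namespace Smoke

/-- index subtype of the only non-empty level `S = univ` over `V = Unit` -/
abbrev U₁ : Type := ((Finset.univ : Finset Unit) : Type)

/-- The one-place model: `X = (∏_{v ∈ univ} ℝ) × Unit` with `(⊗ Lebesgue) ⊗ δ_()`. -/
abbrev X₁ : Type := (U₁ → ℝ) × Unit

/-- the measure `(⊗_{v} Lebesgue) ⊗ δ` on the one-level space -/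
def μ₁ : Measure X₁ := (Measure.pi fun _ : U₁ => (volume : Measure ℝ)).prod (Measure.dirac ())

/-- the canonical index -/
def u₀ : U₁ := ⟨(), Finset.mem_univ _⟩

/-- the level maps: at level `S`, put the `S`-coordinates in place (and `0` elsewhere — only `S = univ` matters) -/
def emb₁ (S : Finset Unit) (p : (((S : Type)) → ℝ) × Unit) : X₁ :=
  (fun w => if h : (w.1 : Unit) ∈ S then p.1 ⟨w.1, h⟩ else 0, ())

/-- (Ported verbatim from the HodgeCMPerL package; no docstring in the source.) -/
theorem emb₁_univ : emb₁ Finset.univ = id := by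
  funext p
  refine Prod.ext (funext fun w => ?_) rfl
  simp only [emb₁, id]
  rw [dif_pos (Finset.mem_univ _)]

/-- The one-place Euler datum for an integrable `F`: `G_univ = X`, `f_() (y) = F((y), ())`. -/
def datum (F : X₁ → ℂ) (hF : Integrable F μ₁) : Datum μ₁ F Unit where
  S₀ := Finset.univ
  Gv _ := ℝ
  μv _ := volume
  fv _ y := F (fun _ => y, ())
  G _ := Set.univ
  G_meas _ := MeasurableSet.univ
  G_mono _ _ _ := le_rfl
  G_cover x := ⟨∅, Set.mem_univ x⟩
  Y _ := Unit
  ν _ := Measure.dirac ()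
  emb := emb₁
  emb_measurableEmbedding S hS := by
    obtain rfl : S = Finset.univ := Finset.univ_subset_iff.mp hS
    rw [emb₁_univ]
    exact MeasurableEmbedding.id
  map_emb S hS := by
    obtain rfl : S = Finset.univ := Finset.univ_subset_iff.mp hS
    rw [emb₁_univ, Measure.restrict_univ, Measure.map_id]
    rfl
  pure_tensor S hS p := by
    obtain rfl : S = Finset.univ := Finset.univ_subset_iff.mp hS
    rw [emb₁_univ, Fintype.prod_subsingleton _ u₀]
    have hp : p = (fun _ => p.1 u₀, ()) :=
      Prod.ext (funext fun v => by rw [Subsingleton.elim v u₀]) rfl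
    exact congrArg F hp
  integrable := hF
  multipliable := (hasProd_fintype _).multipliable

/-- The factorisation theorem fires: `∫ F dμ₁ = ∏' v : Unit, I_v`. -/
theorem integral_eq_smoke (F : X₁ → ℂ) (hF : Integrable F μ₁) :
    ∫ x, F x ∂μ₁ = ∏' v : Unit, (datum F hF).I v :=
  (datum F hF).integral_eq_tprod

end Smoke

end EulerFactorisation
end PerL34
end HodgeCM

end
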